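import Summits.HodgeConjecture.HodgeConjecture.Theorems.F0P3cStCharTSJacCartanWeightDockTwo        -- ★ p852391 (this seat): `weightFormula_eq_normAbs_model_two` (rank-one weight dictionary); brings ★ Q9, ★ model pins
import Summits.HodgeConjecture.HodgeConjecture.Theorems.F0P3cStCharTSCartanSplitTwoH               -- ★ (F0P3a-p03) `exists_isLocalGRegular_centralizer_eq_splitTorusH` (a `G`-regular element of `M₂`); brings ★ WeylHypFibre `centralizer_eq_torusU_of_isRegularElt`
import Summits.HodgeConjecture.HodgeConjecture.Theorems.F0P3cStCharTSStableInvariantsH             -- ★ `isRegularElt_fst_of_isLocalGRegular`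
import Summits.HodgeConjecture.HodgeConjecture.Theorems.F0P3cCMLocalNonsplitBorelTransportU2       -- ★ `localNonsplitEquiv_mem_torusU_iff₂` (torus ↔ torus at `N = 2`)
import Literature.NumberTheory.Automorphic.CMTorusRegularAEPrelims                                 -- ★ `isClosed_torusU_of_t1Space`
import Literature.NumberTheory.Automorphic.LocalUnitaryGroupCongrMeasure                           -- ★ instances `locallyCompactSpace_cmDatum_local`, `secondCountableTopology_cmDatum_local`, `t2Space_cmDatum_local`
import Summits.HodgeConjecture.HodgeConjecture.Theorems.F0P3cStCharTSUpTrWeightIdSplitH           -- (ED. 2) ★ p852454 (F0P3b-p01 g20) (B8a) §1: `discr_charpoly_diag_two_eq_neg_det_mul`, `det_diag_two`, `mul_map_mul_map_eq_one`; brings ★ (B1) `…UpTrU2Chart` (`coe_eq_diag_of_mem_torusU`, `map_entry_mul_entry_eq_one_of_mem_torusU`)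
import HarnessLib

/-!
# F0 · P3c · line LH6 «StCharTS» — ROAD «UP-TR», JAC-LOC₂ brick (B8-D) «SPLIT DOCK₂», file B «CM DOCK₂ (modulo the model socket)»: the local tube-Jacobian socket on
# `U(Φ₂)(L⁺_v)` at the SPLIT torus `M₂ = (cmBorelTriple L 2 v).M`, weight `√(∏_{w′}|disc χ_t|_{w′}·(∏_{w′}|det t|_{w′})⁻¹)` (= `D_H²`, eDH), FROM the model socket at `T(L_w)`

Cell `pub/hodgecm-mathlib`, crux H413 = `stmt-HodgeConjecture-24833` (lane `--supports … --as helper`), route HCCMUnconditional; seat LH6-p04 (g7); ROAD «UP-TR» (holder F0P3-p02 (g23)),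
sub-road «JAC-LOC₂» (sub-dealer LH7-p02 (g8)), brick (B8-D) «SPLIT DOCK₂» dealt 2026-09-02T19:02Z: its OUTPUT is the `hDock` binder of LH7-p02's (B8) TERMINUS
`F0P3cStCharTSUpTrJacCartanSplitH.tubeJacobianLocal_splitCartanH_of_dock` token for token.  THEOREMS ONLY (no definition ∕ instance ∕ notation ∕ named fact ∕ `sorry`); ★-only imports.

WHAT (file B of two).  The (J6)-pattern of ★ JAC-LOC one rank down, transport half: **`tubeJacobianLocal_splitCartan_U2_of_model`** — IF the local tube-Jacobian socket holds on the
one-place MODEL `U′ = U(σ_w, J_w)(L_w)` at its diagonal torus `T(L_w) = torusU σ_w J_w` for every conjugation family `Φ′` and ALL Haar data `(ν′, tm′)`, with the model weight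
`√‖−disc(χ_{t′}) ∕ det t′‖_{L_w}` (file A ∕ ★-pending (B7) ∘ (B5)(B5-M)(B6) deliver exactly this), THEN the socket holds on `G₂ = U(Φ₂)(L⁺_v) = (cmDatum L 2 Φ₂).Local v` at
`T = M₂ = (cmBorelTriple L 2 v).M` for the given `(ν, tm)` with RUNG0's `eDH` radicand weight — in EXACTLY the letters of the `hDock` binder (instances `MeasurableSpace ∕ BorelSpace` on
`G₂` and `G₂ ⧸ T` as binders; local compactness ∕ second countability ∕ `T₂` of `G₂` are the ★ instances of `LocalUnitaryGroupCongrMeasure`).  Proof: ★ Q9 generic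
`tubeJacobianLocal_local_of_forall_model` at `N = 2`, `J = Φ₂`, centred at a `G`-regular `γ₀ ∈ M₂` (★ `exists_isLocalGRegular_centralizer_eq_splitTorusH`, ★
`centralizer_eq_torusU_of_isRegularElt` on both sides, ★ `localNonsplitEquiv_mem_torusU_iff₂`), `Φ′ := e ∘ Φ ∘ (e⁻¹ × e⁻¹)`, `D′ ∘ e = D` by ★ `weightFormula_eq_normAbs_model_two`.
File A (`…UpTrJacSplitModelTwo`, to follow when (B7)(B5)(B5-M)(B6)(B8a) are ★) discharges `hmodel`; the unconditional `tubeJacobianLocal_splitCartan_U2 (L v) (hns)` is then ONE line.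
HONEST LABEL: count-neutral plumbing toward `hUpTr` via WIF-H; conditional on `hmodel` (the model socket₂ at the split torus) until file A lands; HC_CM is proved only modulo the 7 printed
citations (2 remaining: hLiu418 = `stmt-HodgeConjecture-24832`, h413 = `stmt-HodgeConjecture-24833`) until rung 0 closes.

## References
* [HarishChandra1970] Harish-Chandra (notes by G. van Dijk), *Harmonic analysis on reductive p-adic groups*, LNM 162 (1970), Part V §4 Lemma 22; Lemma 42.
* [Rogawski1990] J. D. Rogawski, *Automorphic Representations of Unitary Groups in Three Variables*, Ann. of Math. Stud. 123 (1990), §12.5 pp. 182–183, §4.9 p. 54 (`D_H`).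
* [PlatonovRapinchuk1994] V. Platonov, A. Rapinchuk, *Algebraic Groups and Number Theory* (1994), §5.1 (the one-place model).
-/

set_option autoImplicit false
-- the mandated namespace has the single-problem summit's repeated segment (`HodgeConjecture.HodgeConjecture`)
set_option linter.dupNamespace false

noncomputable section

open MeasureTheory Measure Set Filter Topology Function NumberField IsDedekindDomain Polynomial
open Literature.MeasureTheory.Group
open Literature.NumberTheory.Automorphic Literature.NumberTheory.Automorphic.UnitaryGroup
open Literature.NumberTheory.GaloisRepresentations.IsNonarchimedeanLocalField (normAbs)
open Literature.NumberTheory.Rogawski1990 (IsRegularElt isRegularElt_iff)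
open Summit.HodgeConjecture.HodgeConjecture.Cruxes.H413.F0P3cStCharTSTubeJacobianTransportNonsplit
open Summit.HodgeConjecture.HodgeConjecture.Cruxes.H413.F0P3cStCharTSJacCartanWeightDockTwo (weightFormula_eq_normAbs_model_two)
open scoped ENNReal NNReal Matrix MatrixGroups Pointwise

namespace Summit.HodgeConjecture.HodgeConjecture.Cruxes.H413.F0P3cStCharTSUpTrJacSplitDockTwo

section CM

variable (L : Type) [Field L] [NumberField L] [IsCMField L] (v : HeightOneSpectrum (𝓞 ↥(maximalRealSubfield L)))
  (hns : ∀ w : PlacesOver L v, IsCMField.complexConj L • w.1 = w.1)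
  (w : PlacesOver L v) (hw : IsCMField.complexConj L • w.1 = w.1)

set_option maxHeartbeats 1600000 in
-- the model instantiation elaborates the long socket binders of ★ Q9 at `N = 2`
include hns hw in
/-- **(B8-D) file B «CM DOCK₂ modulo the model socket».**  See the module docstring: the `hDock` letter of ★-pending (B8) TERMINUS on `G₂ = U(Φ₂)(L⁺_v)` at the split torus
`T = M₂`, for the given Haar data `(ν, tm)` and the `eDH` radicand weight, FROM the model socket at `T(L_w)` for all Haar data and every conjugation family (hypothesis `hmodel`,
weight `√‖−disc(χ_{t′}) ∕ det t′‖_{L_w}`). [cite: HarishChandra1970, Lemma 22] [cite: Rogawski1990, §12.5 pp. 182–183; §4.9 p. 54] [cite: PlatonovRapinchuk1994, §5.1] -/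
theorem tubeJacobianLocal_splitCartan_U2_of_model
    [instM : MeasurableSpace ((UnitaryGroup.cmDatum L 2 (Matrix.of fun i j : Fin 2 => if i.val + j.val + 1 = 2 then (1 : L) else 0)).Local v)] [instB : BorelSpace ((UnitaryGroup.cmDatum L 2 (Matrix.of fun i j : Fin 2 => if i.val + j.val + 1 = 2 then (1 : L) else 0)).Local v)]
    {T : Subgroup ((UnitaryGroup.cmDatum L 2 (Matrix.of fun i j : Fin 2 => if i.val + j.val + 1 = 2 then (1 : L) else 0)).Local v)} (hT₂ : T = (cmBorelTriple L 2 v).M)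
    (Φ : ((UnitaryGroup.cmDatum L 2 (Matrix.of fun i j : Fin 2 => if i.val + j.val + 1 = 2 then (1 : L) else 0)).Local v ⧸ T) × ↥T → (UnitaryGroup.cmDatum L 2 (Matrix.of fun i j : Fin 2 => if i.val + j.val + 1 = 2 then (1 : L) else 0)).Local v) (hΦ : ∀ (x : (UnitaryGroup.cmDatum L 2 (Matrix.of fun i j : Fin 2 => if i.val + j.val + 1 = 2 then (1 : L) else 0)).Local v) (t : ↥T), Φ (QuotientGroup.mk x, t) = x * t * x⁻¹)
    (hTc : IsClosed (T : Set ((UnitaryGroup.cmDatum L 2 (Matrix.of fun i j : Fin 2 => if i.val + j.val + 1 = 2 then (1 : L) else 0)).Local v)))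
    [instQM : MeasurableSpace ((UnitaryGroup.cmDatum L 2 (Matrix.of fun i j : Fin 2 => if i.val + j.val + 1 = 2 then (1 : L) else 0)).Local v ⧸ T)] [instQB : BorelSpace ((UnitaryGroup.cmDatum L 2 (Matrix.of fun i j : Fin 2 => if i.val + j.val + 1 = 2 then (1 : L) else 0)).Local v ⧸ T)]
    (ν : Measure ((UnitaryGroup.cmDatum L 2 (Matrix.of fun i j : Fin 2 => if i.val + j.val + 1 = 2 then (1 : L) else 0)).Local v)) [instν₁ : ν.IsHaarMeasure] [instν₂ : ν.IsMulRightInvariant]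
    (tm : Measure ↥T) [instt₁ : tm.IsMulLeftInvariant] [instt₂ : IsFiniteMeasureOnCompacts tm] [instt₃ : tm.IsOpenPosMeasure] [instt₄ : tm.IsInvInvariant]
    -- the MODEL SOCKET₂ at the split torus `T(L_w)` (★-pending (B7)∘(B5)(B5-M)(B6): FILE A), weight in model letters `√‖−disc ∕ det‖_{L_w}`
    (hmodel : ∀ [MeasurableSpace ↥(unitaryGroupOfForm (galAdicCompletionMap (L := L) (IsCMField.complexConj L) hw) (placeForm (Matrix.of fun i j : Fin 2 => if i.val + j.val + 1 = 2 then (1 : L) else 0) w.1))] [BorelSpace ↥(unitaryGroupOfForm (galAdicCompletionMap (L := L) (IsCMField.complexConj L) hw) (placeForm (Matrix.of fun i j : Fin 2 => if i.val + j.val + 1 = 2 then (1 : L) else 0) w.1))]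
      [LocallyCompactSpace ↥(unitaryGroupOfForm (galAdicCompletionMap (L := L) (IsCMField.complexConj L) hw) (placeForm (Matrix.of fun i j : Fin 2 => if i.val + j.val + 1 = 2 then (1 : L) else 0) w.1))] [SecondCountableTopology ↥(unitaryGroupOfForm (galAdicCompletionMap (L := L) (IsCMField.complexConj L) hw) (placeForm (Matrix.of fun i j : Fin 2 => if i.val + j.val + 1 = 2 then (1 : L) else 0) w.1))] [T2Space ↥(unitaryGroupOfForm (galAdicCompletionMap (L := L) (IsCMField.complexConj L) hw) (placeForm (Matrix.of fun i j : Fin 2 => if i.val + j.val + 1 = 2 then (1 : L) else 0) w.1))]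
      [MeasurableSpace (↥(unitaryGroupOfForm (galAdicCompletionMap (L := L) (IsCMField.complexConj L) hw) (placeForm (Matrix.of fun i j : Fin 2 => if i.val + j.val + 1 = 2 then (1 : L) else 0) w.1)) ⧸ torusU (galAdicCompletionMap (L := L) (IsCMField.complexConj L) hw) (placeForm (Matrix.of fun i j : Fin 2 => if i.val + j.val + 1 = 2 then (1 : L) else 0) w.1))]
      [BorelSpace (↥(unitaryGroupOfForm (galAdicCompletionMap (L := L) (IsCMField.complexConj L) hw) (placeForm (Matrix.of fun i j : Fin 2 => if i.val + j.val + 1 = 2 then (1 : L) else 0) w.1)) ⧸ torusU (galAdicCompletionMap (L := L) (IsCMField.complexConj L) hw) (placeForm (Matrix.of fun i j : Fin 2 => if i.val + j.val + 1 = 2 then (1 : L) else 0) w.1))]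
      (Φ' : (↥(unitaryGroupOfForm (galAdicCompletionMap (L := L) (IsCMField.complexConj L) hw) (placeForm (Matrix.of fun i j : Fin 2 => if i.val + j.val + 1 = 2 then (1 : L) else 0) w.1)) ⧸ torusU (galAdicCompletionMap (L := L) (IsCMField.complexConj L) hw) (placeForm (Matrix.of fun i j : Fin 2 => if i.val + j.val + 1 = 2 then (1 : L) else 0) w.1)) × ↥(torusU (galAdicCompletionMap (L := L) (IsCMField.complexConj L) hw) (placeForm (Matrix.of fun i j : Fin 2 => if i.val + j.val + 1 = 2 then (1 : L) else 0) w.1)) → ↥(unitaryGroupOfForm (galAdicCompletionMap (L := L) (IsCMField.complexConj L) hw) (placeForm (Matrix.of fun i j : Fin 2 => if i.val + j.val + 1 = 2 then (1 : L) else 0) w.1)))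
      (_ : ∀ (y : ↥(unitaryGroupOfForm (galAdicCompletionMap (L := L) (IsCMField.complexConj L) hw) (placeForm (Matrix.of fun i j : Fin 2 => if i.val + j.val + 1 = 2 then (1 : L) else 0) w.1))) (t' : ↥(torusU (galAdicCompletionMap (L := L) (IsCMField.complexConj L) hw) (placeForm (Matrix.of fun i j : Fin 2 => if i.val + j.val + 1 = 2 then (1 : L) else 0) w.1))), Φ' (QuotientGroup.mk y, t') = y * t' * y⁻¹)
      (hT'c : IsClosed ((torusU (galAdicCompletionMap (L := L) (IsCMField.complexConj L) hw) (placeForm (Matrix.of fun i j : Fin 2 => if i.val + j.val + 1 = 2 then (1 : L) else 0) w.1)) : Set ↥(unitaryGroupOfForm (galAdicCompletionMap (L := L) (IsCMField.complexConj L) hw) (placeForm (Matrix.of fun i j : Fin 2 => if i.val + j.val + 1 = 2 then (1 : L) else 0) w.1))))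
      (ν' : Measure ↥(unitaryGroupOfForm (galAdicCompletionMap (L := L) (IsCMField.complexConj L) hw) (placeForm (Matrix.of fun i j : Fin 2 => if i.val + j.val + 1 = 2 then (1 : L) else 0) w.1))) [ν'.IsHaarMeasure] [ν'.IsMulRightInvariant]
      (tm' : Measure ↥(torusU (galAdicCompletionMap (L := L) (IsCMField.complexConj L) hw) (placeForm (Matrix.of fun i j : Fin 2 => if i.val + j.val + 1 = 2 then (1 : L) else 0) w.1))) [tm'.IsMulLeftInvariant] [IsFiniteMeasureOnCompacts tm'] [tm'.IsOpenPosMeasure] [tm'.IsInvInvariant],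
      ∀ t₀ : ↥(torusU (galAdicCompletionMap (L := L) (IsCMField.complexConj L) hw) (placeForm (Matrix.of fun i j : Fin 2 => if i.val + j.val + 1 = 2 then (1 : L) else 0) w.1)), IsRegularElt (((t₀ : ↥(unitaryGroupOfForm (galAdicCompletionMap (L := L) (IsCMField.complexConj L) hw) (placeForm (Matrix.of fun i j : Fin 2 => if i.val + j.val + 1 = 2 then (1 : L) else 0) w.1)))) : GL (Fin 2) (w.1.adicCompletion L)) →
        ∃ U : Set ↥(torusU (galAdicCompletionMap (L := L) (IsCMField.complexConj L) hw) (placeForm (Matrix.of fun i j : Fin 2 => if i.val + j.val + 1 = 2 then (1 : L) else 0) w.1)), IsOpen U ∧ t₀ ∈ U ∧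
          ∃ A₀ : Set (↥(unitaryGroupOfForm (galAdicCompletionMap (L := L) (IsCMField.complexConj L) hw) (placeForm (Matrix.of fun i j : Fin 2 => if i.val + j.val + 1 = 2 then (1 : L) else 0) w.1)) ⧸ torusU (galAdicCompletionMap (L := L) (IsCMField.complexConj L) hw) (placeForm (Matrix.of fun i j : Fin 2 => if i.val + j.val + 1 = 2 then (1 : L) else 0) w.1)), MeasurableSet A₀ ∧
            quotientMeasure _ tm' hT'c ν' A₀ ≠ 0 ∧ quotientMeasure _ tm' hT'c ν' A₀ ≠ ∞ ∧
            ∀ V : Set ↥(torusU (galAdicCompletionMap (L := L) (IsCMField.complexConj L) hw) (placeForm (Matrix.of fun i j : Fin 2 => if i.val + j.val + 1 = 2 then (1 : L) else 0) w.1)), MeasurableSet V → V ⊆ U →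
              (∀ t ∈ V, IsRegularElt (((t : ↥(unitaryGroupOfForm (galAdicCompletionMap (L := L) (IsCMField.complexConj L) hw) (placeForm (Matrix.of fun i j : Fin 2 => if i.val + j.val + 1 = 2 then (1 : L) else 0) w.1)))) : GL (Fin 2) (w.1.adicCompletion L))) →
              (∀ n : ↥(unitaryGroupOfForm (galAdicCompletionMap (L := L) (IsCMField.complexConj L) hw) (placeForm (Matrix.of fun i j : Fin 2 => if i.val + j.val + 1 = 2 then (1 : L) else 0) w.1)), n ∉ torusU (galAdicCompletionMap (L := L) (IsCMField.complexConj L) hw) (placeForm (Matrix.of fun i j : Fin 2 => if i.val + j.val + 1 = 2 then (1 : L) else 0) w.1) →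
                ∀ t ∈ V, ∀ t' ∈ V, ((t' : ↥(torusU (galAdicCompletionMap (L := L) (IsCMField.complexConj L) hw) (placeForm (Matrix.of fun i j : Fin 2 => if i.val + j.val + 1 = 2 then (1 : L) else 0) w.1))) : ↥(unitaryGroupOfForm (galAdicCompletionMap (L := L) (IsCMField.complexConj L) hw) (placeForm (Matrix.of fun i j : Fin 2 => if i.val + j.val + 1 = 2 then (1 : L) else 0) w.1))) ≠ n * t * n⁻¹) →
                ν' (Φ' '' (A₀ ×ˢ V)) = quotientMeasure _ tm' hT'c ν' A₀ *
                  ∫⁻ t in V, ↑(NNReal.sqrt (normAbs (w.1.adicCompletion L) (-(((t : ↥(unitaryGroupOfForm (galAdicCompletionMap (L := L) (IsCMField.complexConj L) hw) (placeForm (Matrix.of fun i j : Fin 2 => if i.val + j.val + 1 = 2 then (1 : L) else 0) w.1))) : GL (Fin 2) (w.1.adicCompletion L)) : Matrix (Fin 2) (Fin 2) (w.1.adicCompletion L)).charpoly.discr / (((t : ↥(unitaryGroupOfForm (galAdicCompletionMap (L := L) (IsCMField.complexConj L) hw) (placeForm (Matrix.of fun i j : Fin 2 => if i.val + j.val + 1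 = 2 then (1 : L) else 0) w.1))) : GL (Fin 2) (w.1.adicCompletion L)) : Matrix (Fin 2) (Fin 2) (w.1.adicCompletion L)).det))) ∂tm') :
    ∀ t₀ : ↥T, IsRegularElt (((t₀ : (UnitaryGroup.cmDatum L 2 (Matrix.of fun i j : Fin 2 => if i.val + j.val + 1 = 2 then (1 : L) else 0)).Local v)).val : GL (Fin 2) (UnitaryGroup.LocalRing L v)) →
      ∃ U : Set ↥T, IsOpen U ∧ t₀ ∈ U ∧
        ∃ A₀ : Set ((UnitaryGroup.cmDatum L 2 (Matrix.of fun i j : Fin 2 => if i.val + j.val + 1 = 2 then (1 : L) else 0)).Local v ⧸ T), MeasurableSet A₀ ∧ (quotientMeasure T tm hTc ν) A₀ ≠ 0 ∧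
          (quotientMeasure T tm hTc ν) A₀ ≠ ∞ ∧
          ∀ V : Set ↥T, MeasurableSet V → V ⊆ U → (∀ t ∈ V, IsRegularElt (((t : (UnitaryGroup.cmDatum L 2 (Matrix.of fun i j : Fin 2 => if i.val + j.val + 1 = 2 then (1 : L) else 0)).Local v)).val : GL (Fin 2) (UnitaryGroup.LocalRing L v))) →
            (∀ n : (UnitaryGroup.cmDatum L 2 (Matrix.of fun i j : Fin 2 => if i.val + j.val + 1 = 2 then (1 : L) else 0)).Local v, n ∉ T → ∀ t ∈ V, ∀ t' ∈ V, ((t' : ↥T) : (UnitaryGroup.cmDatum L 2 (Matrix.of fun i j : Fin 2 => if i.val + j.val + 1 = 2 then (1 : L) else 0)).Local v) ≠ n * t * n⁻¹) →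
              ν (Φ '' (A₀ ×ˢ V)) = (quotientMeasure T tm hTc ν) A₀ *
                ∫⁻ t in V, ↑(NNReal.sqrt ((∏ w' : PlacesOver L v, normAbs (w'.1.adicCompletion L) ((((t : (UnitaryGroup.cmDatum L 2 (Matrix.of fun i j : Fin 2 => if i.val + j.val + 1 = 2 then (1 : L) else 0)).Local v).val : GL (Fin 2) (UnitaryGroup.LocalRing L v)).val.charpoly.discr) w')) * (∏ w' : PlacesOver L v, normAbs (w'.1.adicCompletion L) ((((t : (UnitaryGroup.cmDatum L 2 (Matrix.of fun i j : Fin 2 => if i.val + j.val + 1 = 2 then (1 : L) else 0)).Local v).val : GL (Fin 2) (UnitaryGroup.LocalRing L v)).val.det) w'))⁻¹)) ∂tm := by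
  classical
  intro s₀ hs₀
  -- ### the one-place model
  set K := w.1.adicCompletion L with hK
  set σ := galAdicCompletionMap (L := L) (IsCMField.complexConj L) hw with hσdef
  set J := placeForm (Matrix.of fun i j : Fin 2 => if i.val + j.val + 1 = 2 then (1 : L) else 0) w.1 with hJdef
  set e := localNonsplitEquiv (IsCMField.complexConj L) (Matrix.of fun i j : Fin 2 => if i.val + j.val + 1 = 2 then (1 : L) else 0) (IsCMField.complexConj_ne_one L) w hw with hedef
  haveI instLC : LocallyCompactSpace ((UnitaryGroup.cmDatum L 2 (Matrix.of fun i j : Fin 2 => if i.val + j.val + 1 = 2 then (1 : L) else 0)).Local v) := inferInstance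
  haveI instSC : SecondCountableTopology ((UnitaryGroup.cmDatum L 2 (Matrix.of fun i j : Fin 2 => if i.val + j.val + 1 = 2 then (1 : L) else 0)).Local v) := inferInstance
  haveI instT2 : T2Space ((UnitaryGroup.cmDatum L 2 (Matrix.of fun i j : Fin 2 => if i.val + j.val + 1 = 2 then (1 : L) else 0)).Local v) := inferInstance
  -- ### a regular element `γ₀` of the split torus with `Z(γ₀) = M₂ = T`
  obtain ⟨γH, hγHreg, hγHM, -, -⟩ := F0P3cStCharTSCartanSplitTwoH.exists_isLocalGRegular_centralizer_eq_splitTorusH L v hns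
  set γ₀ : (UnitaryGroup.cmDatum L 2 (Matrix.of fun i j : Fin 2 => if i.val + j.val + 1 = 2 then (1 : L) else 0)).Local v := γH.1 with hγ₀def
  have hγ₀ : IsRegularElt ((γ₀.val : GL (Fin 2) (UnitaryGroup.LocalRing L v))) :=
    F0P3cStCharTSStableInvariantsH.isRegularElt_fst_of_isLocalGRegular L v hγHreg
  have hγ₀M : (γ₀ : ↥(unitaryGroupOfForm (conjLocal L (IsCMField.complexConj L) v) (cmLocalForm L 2 v))) ∈
      torusU (conjLocal L (IsCMField.complexConj L) v) (cmLocalForm L 2 v) := hγHM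
  have hT : T = Subgroup.centralizer ({γ₀} : Set ((UnitaryGroup.cmDatum L 2 (Matrix.of fun i j : Fin 2 => if i.val + j.val + 1 = 2 then (1 : L) else 0)).Local v)) := by
    rw [hT₂]
    exact (F0P3cStCharTSWeylHypFibre.centralizer_eq_torusU_of_isRegularElt (conjLocal L (IsCMField.complexConj L) v) (cmLocalForm L 2 v) hγ₀M hγ₀).symm
  -- ### the model torus `T' = T(L_w) = Z(e γ₀)`
  have hγ₀' : IsRegularElt (((e γ₀ : ↥(unitaryGroupOfForm (galAdicCompletionMap (L := L) (IsCMField.complexConj L) hw) (placeForm (Matrix.of fun i j : Fin 2 => if i.val + j.val + 1 = 2 then (1 : L) else 0) w.1)))) : GL (Fin 2) K) :=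
    (isRegularElt_localNonsplitEquiv_iff (IsCMField.complexConj L) 2 (Matrix.of fun i j : Fin 2 => if i.val + j.val + 1 = 2 then (1 : L) else 0) (IsCMField.complexConj_ne_one L) w hw γ₀).2 hγ₀
  have hγ₀'M : e γ₀ ∈ torusU σ J :=
    (F0P3cCMLocalNonsplitBorelTransportU2.localNonsplitEquiv_mem_torusU_iff₂ L v w hw γ₀).2 hγHM
  have hT' : ∀ g', g' ∈ torusU σ J ↔ g' * e γ₀ = e γ₀ * g' := fun g' => by
    rw [← F0P3cStCharTSWeylHypFibre.centralizer_eq_torusU_of_isRegularElt σ J hγ₀'M hγ₀', Subgroup.mem_centralizer_iff]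
    exact ⟨fun h => (h _ (Set.mem_singleton _)).symm, fun h x hx => by rw [Set.mem_singleton_iff.1 hx]; exact h.symm⟩
  set T' : Subgroup ↥(unitaryGroupOfForm (galAdicCompletionMap (L := L) (IsCMField.complexConj L) hw) (placeForm (Matrix.of fun i j : Fin 2 => if i.val + j.val + 1 = 2 then (1 : L) else 0) w.1)) := torusU σ J with hT'def
  have hT'c : IsClosed (T' : Set ↥(unitaryGroupOfForm (galAdicCompletionMap (L := L) (IsCMField.complexConj L) hw) (placeForm (Matrix.of fun i j : Fin 2 => if i.val + j.val + 1 = 2 then (1 : L) else 0) w.1))) := isClosed_torusU_of_t1Space σ J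
  have hTT' : ∀ g : (UnitaryGroup.cmDatum L 2 (Matrix.of fun i j : Fin 2 => if i.val + j.val + 1 = 2 then (1 : L) else 0)).Local v, e.toMulEquiv g ∈ T' ↔ g ∈ T :=
    localNonsplitEquiv_mem_iff (IsCMField.complexConj L) 2 (Matrix.of fun i j : Fin 2 => if i.val + j.val + 1 = 2 then (1 : L) else 0) (IsCMField.complexConj_ne_one L) w hw hT hT'
  -- `e⁻¹` read with values in the `cmDatum`-typed carrier `G₂`, and its algebra
  let es : ↥(unitaryGroupOfForm (galAdicCompletionMap (L := L) (IsCMField.complexConj L) hw) (placeForm (Matrix.of fun i j : Fin 2 => if i.val + j.val + 1 = 2 then (1 : L) else 0) w.1)) → (UnitaryGroup.cmDatum L 2 (Matrix.of fun i j : Fin 2 => if i.val + j.val + 1 = 2 then (1 : L) else 0)).Local v := fun y => e.symm y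
  have hes_mul : ∀ a b, es (a * b) = es a * es b := fun a b => map_mul e.symm a b
  have hes_inv : ∀ a, es a⁻¹ = (es a)⁻¹ := fun a => map_inv e.symm a
  have he_es : ∀ y, e (es y) = y := fun y => e.apply_symm_apply y
  have hes_e : ∀ g : (UnitaryGroup.cmDatum L 2 (Matrix.of fun i j : Fin 2 => if i.val + j.val + 1 = 2 then (1 : L) else 0)).Local v, es (e g) = g := fun g => e.symm_apply_apply g
  have hes_c : Continuous es := e.symm.continuous
  have hmemT' : ∀ g' : ↥(unitaryGroupOfForm (galAdicCompletionMap (L := L) (IsCMField.complexConj L) hw) (placeForm (Matrix.of fun i j : Fin 2 => if i.val + j.val + 1 = 2 then (1 : L) else 0) w.1)), g' ∈ T' ↔ es g' ∈ T := fun g' => by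
    have h := hTT' (es g')
    have h2 : e.toMulEquiv (es g') = g' := he_es g'
    rw [h2] at h
    exact h
  -- ### transported instances and Borel structures on the model
  haveI : T2Space ↥(unitaryGroupOfForm (galAdicCompletionMap (L := L) (IsCMField.complexConj L) hw) (placeForm (Matrix.of fun i j : Fin 2 => if i.val + j.val + 1 = 2 then (1 : L) else 0) w.1)) := e.symm.toHomeomorph.symm.t2Space
  haveI : SecondCountableTopology ↥(unitaryGroupOfForm (galAdicCompletionMap (L := L) (IsCMField.complexConj L) hw) (placeForm (Matrix.of fun i j : Fin 2 => if i.val + j.val + 1 = 2 then (1 : L) else 0) w.1)) := e.symm.toHomeomorph.secondCountableTopology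
  haveI : LocallyCompactSpace ↥(unitaryGroupOfForm (galAdicCompletionMap (L := L) (IsCMField.complexConj L) hw) (placeForm (Matrix.of fun i j : Fin 2 => if i.val + j.val + 1 = 2 then (1 : L) else 0) w.1)) := e.symm.toHomeomorph.isClosedEmbedding.locallyCompactSpace
  letI : MeasurableSpace ↥(unitaryGroupOfForm (galAdicCompletionMap (L := L) (IsCMField.complexConj L) hw) (placeForm (Matrix.of fun i j : Fin 2 => if i.val + j.val + 1 = 2 then (1 : L) else 0) w.1)) := borel _
  haveI : BorelSpace ↥(unitaryGroupOfForm (galAdicCompletionMap (L := L) (IsCMField.complexConj L) hw) (placeForm (Matrix.of fun i j : Fin 2 => if i.val + j.val + 1 = 2 then (1 : L) else 0) w.1)) := ⟨rfl⟩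
  letI : MeasurableSpace (↥(unitaryGroupOfForm (galAdicCompletionMap (L := L) (IsCMField.complexConj L) hw) (placeForm (Matrix.of fun i j : Fin 2 => if i.val + j.val + 1 = 2 then (1 : L) else 0) w.1)) ⧸ T') := borel _
  haveI : BorelSpace (↥(unitaryGroupOfForm (galAdicCompletionMap (L := L) (IsCMField.complexConj L) hw) (placeForm (Matrix.of fun i j : Fin 2 => if i.val + j.val + 1 = 2 then (1 : L) else 0) w.1)) ⧸ T') := ⟨rfl⟩
  -- ### the model conjugation family `Φ' = e ∘ Φ ∘ (e⁻¹ × e⁻¹)`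
  let qm : ↥(unitaryGroupOfForm (galAdicCompletionMap (L := L) (IsCMField.complexConj L) hw) (placeForm (Matrix.of fun i j : Fin 2 => if i.val + j.val + 1 = 2 then (1 : L) else 0) w.1)) ⧸ T' → (UnitaryGroup.cmDatum L 2 (Matrix.of fun i j : Fin 2 => if i.val + j.val + 1 = 2 then (1 : L) else 0)).Local v ⧸ T :=
    Quotient.map' es fun a b hab => by
      rw [QuotientGroup.leftRel_apply] at hab ⊢
      have h : es (a⁻¹ * b) ∈ T := (hmemT' _).1 hab
      rw [hes_mul, hes_inv] at h
      exact h
  have hqm : ∀ y : ↥(unitaryGroupOfForm (galAdicCompletionMap (L := L) (IsCMField.complexConj L) hw) (placeForm (Matrix.of fun i j : Fin 2 => if i.val + j.val + 1 = 2 then (1 : L) else 0) w.1)), qm (QuotientGroup.mk y) = QuotientGroup.mk (es y) := fun y => rfl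
  let Φ' : (↥(unitaryGroupOfForm (galAdicCompletionMap (L := L) (IsCMField.complexConj L) hw) (placeForm (Matrix.of fun i j : Fin 2 => if i.val + j.val + 1 = 2 then (1 : L) else 0) w.1)) ⧸ T') × ↥T' → ↥(unitaryGroupOfForm (galAdicCompletionMap (L := L) (IsCMField.complexConj L) hw) (placeForm (Matrix.of fun i j : Fin 2 => if i.val + j.val + 1 = 2 then (1 : L) else 0) w.1)) :=
    fun p => e (Φ (qm p.1, ⟨es (p.2 : ↥(unitaryGroupOfForm (galAdicCompletionMap (L := L) (IsCMField.complexConj L) hw) (placeForm (Matrix.of fun i j : Fin 2 => if i.val + j.val + 1 = 2 then (1 : L) else 0) w.1))), (hmemT' _).1 p.2.2⟩))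
  have hΦ' : ∀ (y : ↥(unitaryGroupOfForm (galAdicCompletionMap (L := L) (IsCMField.complexConj L) hw) (placeForm (Matrix.of fun i j : Fin 2 => if i.val + j.val + 1 = 2 then (1 : L) else 0) w.1))) (t' : ↥T'), Φ' (QuotientGroup.mk y, t') = y * t' * y⁻¹ := by
    intro y t'
    show e (Φ (qm (QuotientGroup.mk y), ⟨es (t' : ↥(unitaryGroupOfForm (galAdicCompletionMap (L := L) (IsCMField.complexConj L) hw) (placeForm (Matrix.of fun i j : Fin 2 => if i.val + j.val + 1 = 2 then (1 : L) else 0) w.1))), (hmemT' _).1 t'.2⟩)) = y * t' * y⁻¹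
    rw [hqm, hΦ]
    show e (es y * es (t' : ↥(unitaryGroupOfForm (galAdicCompletionMap (L := L) (IsCMField.complexConj L) hw) (placeForm (Matrix.of fun i j : Fin 2 => if i.val + j.val + 1 = 2 then (1 : L) else 0) w.1))) * (es y)⁻¹) = y * t' * y⁻¹
    rw [← hes_inv, ← hes_mul, ← hes_mul, he_es]
  -- ### the weights: `D = √radicand` on `T`, `D' = √‖−disc ∕ det‖` on `T'`, `D' ∘ e = D` by the rank-one dictionary
  let D : ↥T → ℝ≥0 := fun t => NNReal.sqrt
    ((∏ w' : PlacesOver L v, normAbs (w'.1.adicCompletion L) ((((t : (UnitaryGroup.cmDatum L 2 (Matrix.of fun i j : Fin 2 => if i.val + j.val + 1 = 2 then (1 : L) else 0)).Local v).val : GL (Fin 2) (UnitaryGroup.LocalRing L v)).val.charpoly.discr) w')) *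
      (∏ w' : PlacesOver L v, normAbs (w'.1.adicCompletion L) ((((t : (UnitaryGroup.cmDatum L 2 (Matrix.of fun i j : Fin 2 => if i.val + j.val + 1 = 2 then (1 : L) else 0)).Local v).val : GL (Fin 2) (UnitaryGroup.LocalRing L v)).val.det) w'))⁻¹)
  let D' : ↥T' → ℝ≥0 := fun t' => NNReal.sqrt (normAbs K
    (-(((t' : ↥(unitaryGroupOfForm (galAdicCompletionMap (L := L) (IsCMField.complexConj L) hw) (placeForm (Matrix.of fun i j : Fin 2 => if i.val + j.val + 1 = 2 then (1 : L) else 0) w.1))) : GL (Fin 2) K) : Matrix (Fin 2) (Fin 2) K).charpoly.discr / (((t' : ↥(unitaryGroupOfForm (galAdicCompletionMap (L := L) (IsCMField.complexConj L) hw) (placeForm (Matrix.of fun i j : Fin 2 => if i.val + j.val + 1 = 2 then (1 : L) else 0) w.1))) : GL (Fin 2) K) : Matrix (Fin 2) (Fin 2) K).det))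
  have hDD' : ∀ (t : ↥T) (h : e.toMulEquiv (t : (UnitaryGroup.cmDatum L 2 (Matrix.of fun i j : Fin 2 => if i.val + j.val + 1 = 2 then (1 : L) else 0)).Local v) ∈ T'), D' ⟨e.toMulEquiv (t : (UnitaryGroup.cmDatum L 2 (Matrix.of fun i j : Fin 2 => if i.val + j.val + 1 = 2 then (1 : L) else 0)).Local v), h⟩ = D t := by
    intro t h
    show NNReal.sqrt _ = NNReal.sqrt _
    rw [weightFormula_eq_normAbs_model_two L v w hw (t : (UnitaryGroup.cmDatum L 2 (Matrix.of fun i j : Fin 2 => if i.val + j.val + 1 = 2 then (1 : L) else 0)).Local v)]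
    rfl
  -- ### the model socket (hypothesis) at `(Φ', D')`
  have hmodel' := fun (ν' : Measure ↥(unitaryGroupOfForm (galAdicCompletionMap (L := L) (IsCMField.complexConj L) hw) (placeForm (Matrix.of fun i j : Fin 2 => if i.val + j.val + 1 = 2 then (1 : L) else 0) w.1))) (i₁ : ν'.IsHaarMeasure) (i₂ : ν'.IsMulRightInvariant) (tm' : Measure ↥T')
      (j₁ : tm'.IsMulLeftInvariant) (j₂ : IsFiniteMeasureOnCompacts tm') (j₃ : tm'.IsOpenPosMeasure) (j₄ : tm'.IsInvInvariant) =>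
    hmodel Φ' hΦ' hT'c ν' tm'
  -- ### ★ Q9 generic (instances passed by name, as ★ Q9-CM does)
  exact @tubeJacobianLocal_local_of_forall_model _ _ _ _ _ _ _ _ (IsCMField.complexConj L) 2 (Matrix.of fun i j : Fin 2 => if i.val + j.val + 1 = 2 then (1 : L) else 0) _
    (IsCMField.complexConj_ne_one L) w hw γ₀ T hT T' hT' instM instB instLC instSC instT2 hTc instQM instQB ν instν₁ instν₂ tm instt₁ instt₂ instt₃ instt₄ Φ hΦ D
    _ _ _ _ _ hT'c _ _ Φ' hΦ' D' hDD' hmodel' s₀ hs₀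

end CM

/-! ## §2 (ED. 2) The MODEL weight dictionary `√‖−disc χ_t ∕ det t‖ = √(‖a − 1‖·‖a⁻¹ − 1‖)` on the split torus `T(K)` of `U(σ, Φ₂)(K)`, and file B in the `D₂` letter

ED. 2 (2026-09-02, same seat; append-only: §CM byte-identical, one `import` added).  Sub-road «JAC-LOC₂»'s model bricks (B5)(B5-M)(B6)(B7)(B7b) carry the
tube-Jacobian weight on `T(K) = torusU σ J`, `J = Φ₂`, in the letter **`D₂ t = √(‖a − 1‖_K · ‖a⁻¹ − 1‖_K)`, `a = t₀₀ · σ t₀₀`** (sub-dealer LH7-p02 (g8)'s WEIGHT LETTER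
2026-09-02T18:56:32Z; FIELD inverse), while file B's `hmodel` (§CM) reads `√‖−disc(χ_t) ∕ det t‖_K`.  On the torus the two agree pointwise — for `t = diag(d, e)` with the
unitarity relations `σd·e = 1 = σe·d` (★ (B1)): `disc χ_t = (d − e)² = −(de)·((dσd − 1)(eσe − 1))` (★ (B8a) §1, generic `CommRing`), `det t = de ≠ 0`, `eσe = (dσd)⁻¹` — so
`−disc ∕ det = (a − 1)(a⁻¹ − 1)` EXACTLY and `‖·‖_K` is multiplicative.  Hence **`tubeJacobianLocal_splitCartan_U2_of_model₂`**: file B's head with the model socket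
hypothesis in the `D₂` letter (`hmodel₂`), by `lintegral_congr` under `∫⁻ t in V … ∂tm′` — whichever of the two letters (B7b)'s terminus `…UpTrU2Horbit.tubeJacobianLocal_splitTorus_model`
lands in, the unconditional `tubeJacobianLocal_splitCartan_U2 (L v) (hns)` (ED. 3) is ONE line over `_of_model` or `_of_model₂`. -/

section ModelWeight

variable {K : Type*} [Field K] [ValuativeRel K] [TopologicalSpace K] [IsNonarchimedeanLocalField K]
  (σ : K →+* K) {J : Matrix (Fin 2) (Fin 2) K} (hJ : J = (StdForm.antidiagonal 2).over K)

include hJ in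
/-- **THE MODEL WEIGHT DICTIONARY ON THE SPLIT TORUS**: for `t ∈ T(K) = torusU σ Φ₂` (so `↑↑t = diag(d, e)`, `σd·e = 1 = σe·d`, ★ (B1) `coe_eq_diag_of_mem_torusU` ∕
`map_entry_mul_entry_eq_one_of_mem_torusU`), **`√‖−disc(χ_t) ∕ det t‖_K = √(‖a − 1‖_K · ‖a⁻¹ − 1‖_K)`, `a := d · σd`** — exact identity `−disc ∕ det = (a − 1)(a⁻¹ − 1)` from
★ (B8a) §1 `discr_charpoly_diag_two_eq_neg_det_mul` (`(d − e)² = −(de)·((dσd − 1)(eσe − 1))`), `det = de ≠ 0`, `eσe = (dσd)⁻¹` (`mul_map_mul_map_eq_one`), and multiplicativity of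
`‖·‖_K`; the print line «`|D(m)| = |a − 1|·|a⁻¹ − 1|` up to the modulus» for `U(2)`'s split torus. [cite: Rogawski1990, §12.5 pp. 182–183; §4.9 p. 54] [cite: HarishChandra1970, Lemma 22] -/
theorem sqrt_normAbs_neg_discr_div_det_eq_of_mem_torusU {t : ↥(unitaryGroupOfForm σ J)} (ht : t ∈ torusU σ J) :
    NNReal.sqrt (normAbs K (-((t : GL (Fin 2) K) : Matrix (Fin 2) (Fin 2) K).charpoly.discr / ((t : GL (Fin 2) K) : Matrix (Fin 2) (Fin 2) K).det)) =
      NNReal.sqrt (normAbs K ((((t : GL (Fin 2) K) : Matrix (Fin 2) (Fin 2) K) 0 0) * σ (((t : GL (Fin 2) K) : Matrix (Fin 2) (Fin 2) K) 0 0) - 1) *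
        normAbs K (((((t : GL (Fin 2) K) : Matrix (Fin 2) (Fin 2) K) 0 0) * σ (((t : GL (Fin 2) K) : Matrix (Fin 2) (Fin 2) K) 0 0))⁻¹ - 1)) := by
  obtain ⟨h₁, h₂⟩ := F0P3cStCharTSUpTrU2Chart.map_entry_mul_entry_eq_one_of_mem_torusU σ hJ ht
  have hshape := F0P3cStCharTSUpTrU2Chart.coe_eq_diag_of_mem_torusU σ ht
  set d : K := ((t : GL (Fin 2) K) : Matrix (Fin 2) (Fin 2) K) 0 0 with hd
  set e : K := ((t : GL (Fin 2) K) : Matrix (Fin 2) (Fin 2) K) 1 1 with he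
  have hd0 : d ≠ 0 := right_ne_zero_of_mul_eq_one h₂
  have he0 : e ≠ 0 := right_ne_zero_of_mul_eq_one h₁
  have hinv : e * σ e = (d * σ d)⁻¹ := eq_inv_of_mul_eq_one_right (F0P3cStCharTSUpTrWeightIdSplitH.mul_map_mul_map_eq_one σ h₁ h₂)
  rw [hshape, F0P3cStCharTSUpTrWeightIdSplitH.discr_charpoly_diag_two_eq_neg_det_mul σ h₁ h₂, F0P3cStCharTSUpTrWeightIdSplitH.det_diag_two, neg_mul, neg_neg,
    mul_div_cancel_left₀ _ (mul_ne_zero hd0 he0), map_mul (normAbs K), hinv]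

end ModelWeight

section CMTwo

variable (L : Type) [Field L] [NumberField L] [IsCMField L] (v : HeightOneSpectrum (𝓞 ↥(maximalRealSubfield L)))
  (hns : ∀ w : PlacesOver L v, IsCMField.complexConj L • w.1 = w.1)
  (w : PlacesOver L v) (hw : IsCMField.complexConj L • w.1 = w.1)

include hns in
/-- **(B8-D) file B in the `D₂` letter «CM DOCK₂ modulo the model socket, weight `√(‖a − 1‖·‖a⁻¹ − 1‖)`».**  §CM's `tubeJacobianLocal_splitCartan_U2_of_model` with the model socket
hypothesis re-lettered to sub-road «JAC-LOC₂»'s weight `D₂ t′ = √(‖a − 1‖_{L_w}·‖a⁻¹ − 1‖_{L_w})`, `a = t′₀₀ · σ_w t′₀₀` (`hmodel₂`; everything else token for token): the two integrands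
agree on `T(L_w)` by §2 `sqrt_normAbs_neg_discr_div_det_eq_of_mem_torusU` at `σ_w`, `(Φ₂)_w = Φ₂ over L_w` (★ `placeForm_antidiagTwo_eq`), so `hmodel₂ ⇒ hmodel` under `∫⁻ … ∂tm′`
(`lintegral_congr`).  Consumed by ED. 3's one-liner once (B7b)'s `tubeJacobianLocal_splitTorus_model` is ★. [cite: HarishChandra1970, Lemma 22] [cite: Rogawski1990, §12.5 pp. 182–183; §4.9 p. 54]
[cite: PlatonovRapinchuk1994, §5.1] -/
theorem tubeJacobianLocal_splitCartan_U2_of_model₂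
    [instM : MeasurableSpace ((UnitaryGroup.cmDatum L 2 (Matrix.of fun i j : Fin 2 => if i.val + j.val + 1 = 2 then (1 : L) else 0)).Local v)] [instB : BorelSpace ((UnitaryGroup.cmDatum L 2 (Matrix.of fun i j : Fin 2 => if i.val + j.val + 1 = 2 then (1 : L) else 0)).Local v)]
    {T : Subgroup ((UnitaryGroup.cmDatum L 2 (Matrix.of fun i j : Fin 2 => if i.val + j.val + 1 = 2 then (1 : L) else 0)).Local v)} (hT₂ : T = (cmBorelTriple L 2 v).M)
    (Φ : ((UnitaryGroup.cmDatum L 2 (Matrix.of fun i j : Fin 2 => if i.val + j.val + 1 = 2 then (1 : L) else 0)).Local v ⧸ T) × ↥T → (UnitaryGroup.cmDatum L 2 (Matrix.of fun i j : Fin 2 => if i.val + j.val + 1 = 2 then (1 : L) else 0)).Local v) (hΦ : ∀ (x : (UnitaryGroup.cmDatum L 2 (Matrix.of fun i j : Fin 2 => if i.val + j.val + 1 = 2 then (1 : L) else 0)).Local v) (t : ↥T), Φ (QuotientGroup.mk x, t) = x * t * x⁻¹)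
    (hTc : IsClosed (T : Set ((UnitaryGroup.cmDatum L 2 (Matrix.of fun i j : Fin 2 => if i.val + j.val + 1 = 2 then (1 : L) else 0)).Local v)))
    [instQM : MeasurableSpace ((UnitaryGroup.cmDatum L 2 (Matrix.of fun i j : Fin 2 => if i.val + j.val + 1 = 2 then (1 : L) else 0)).Local v ⧸ T)] [instQB : BorelSpace ((UnitaryGroup.cmDatum L 2 (Matrix.of fun i j : Fin 2 => if i.val + j.val + 1 = 2 then (1 : L) else 0)).Local v ⧸ T)]
    (ν : Measure ((UnitaryGroup.cmDatum L 2 (Matrix.of fun i j : Fin 2 => if i.val + j.val + 1 = 2 then (1 : L) else 0)).Local v)) [instν₁ : ν.IsHaarMeasure] [instν₂ : ν.IsMulRightInvariant]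
    (tm : Measure ↥T) [instt₁ : tm.IsMulLeftInvariant] [instt₂ : IsFiniteMeasureOnCompacts tm] [instt₃ : tm.IsOpenPosMeasure] [instt₄ : tm.IsInvInvariant]
    -- the MODEL SOCKET₂ at the split torus `T(L_w)` in sub-road «JAC-LOC₂»'s `D₂` WEIGHT LETTER `√(‖a − 1‖·‖a⁻¹ − 1‖)`, `a = t₀₀ · σ_w t₀₀` ((B7b) 18:56:32Z)
    (hmodel₂ : ∀ [MeasurableSpace ↥(unitaryGroupOfForm (galAdicCompletionMap (L := L) (IsCMField.complexConj L) hw) (placeForm (Matrix.of fun i j : Fin 2 => if i.val + j.val + 1 = 2 then (1 : L) else 0) w.1))] [BorelSpace ↥(unitaryGroupOfForm (galAdicCompletionMap (L := L) (IsCMField.complexConj L) hw) (placeForm (Matrix.of fun i j : Fin 2 => if i.val + j.val + 1 = 2 then (1 : L) else 0) w.1))]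
      [LocallyCompactSpace ↥(unitaryGroupOfForm (galAdicCompletionMap (L := L) (IsCMField.complexConj L) hw) (placeForm (Matrix.of fun i j : Fin 2 => if i.val + j.val + 1 = 2 then (1 : L) else 0) w.1))] [SecondCountableTopology ↥(unitaryGroupOfForm (galAdicCompletionMap (L := L) (IsCMField.complexConj L) hw) (placeForm (Matrix.of fun i j : Fin 2 => if i.val + j.val + 1 = 2 then (1 : L) else 0) w.1))] [T2Space ↥(unitaryGroupOfForm (galAdicCompletionMap (L := L) (IsCMField.complexConj L) hw) (placeForm (Matrix.of fun i j : Fin 2 => if i.val + j.val + 1 = 2 then (1 : L) else 0) w.1))]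
      [MeasurableSpace (↥(unitaryGroupOfForm (galAdicCompletionMap (L := L) (IsCMField.complexConj L) hw) (placeForm (Matrix.of fun i j : Fin 2 => if i.val + j.val + 1 = 2 then (1 : L) else 0) w.1)) ⧸ torusU (galAdicCompletionMap (L := L) (IsCMField.complexConj L) hw) (placeForm (Matrix.of fun i j : Fin 2 => if i.val + j.val + 1 = 2 then (1 : L) else 0) w.1))]
      [BorelSpace (↥(unitaryGroupOfForm (galAdicCompletionMap (L := L) (IsCMField.complexConj L) hw) (placeForm (Matrix.of fun i j : Fin 2 => if i.val + j.val + 1 = 2 then (1 : L) else 0) w.1)) ⧸ torusU (galAdicCompletionMap (L := L) (IsCMField.complexConj L) hw) (placeForm (Matrix.of fun i j : Fin 2 => if i.val + j.val + 1 = 2 then (1 : L) else 0) w.1))]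
      (Φ' : (↥(unitaryGroupOfForm (galAdicCompletionMap (L := L) (IsCMField.complexConj L) hw) (placeForm (Matrix.of fun i j : Fin 2 => if i.val + j.val + 1 = 2 then (1 : L) else 0) w.1)) ⧸ torusU (galAdicCompletionMap (L := L) (IsCMField.complexConj L) hw) (placeForm (Matrix.of fun i j : Fin 2 => if i.val + j.val + 1 = 2 then (1 : L) else 0) w.1)) × ↥(torusU (galAdicCompletionMap (L := L) (IsCMField.complexConj L) hw) (placeForm (Matrix.of fun i j : Fin 2 => if i.val + j.val + 1 = 2 then (1 : L) else 0) w.1)) → ↥(unitaryGroupOfForm (galAdicCompletionMap (L := L) (IsCMField.complexConj L) hw) (placeForm (Matrix.of fun i j : Fin 2 => if i.val + j.val + 1 = 2 then (1 : L) else 0) w.1)))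
      (_ : ∀ (y : ↥(unitaryGroupOfForm (galAdicCompletionMap (L := L) (IsCMField.complexConj L) hw) (placeForm (Matrix.of fun i j : Fin 2 => if i.val + j.val + 1 = 2 then (1 : L) else 0) w.1))) (t' : ↥(torusU (galAdicCompletionMap (L := L) (IsCMField.complexConj L) hw) (placeForm (Matrix.of fun i j : Fin 2 => if i.val + j.val + 1 = 2 then (1 : L) else 0) w.1))), Φ' (QuotientGroup.mk y, t') = y * t' * y⁻¹)
      (hT'c : IsClosed ((torusU (galAdicCompletionMap (L := L) (IsCMField.complexConj L) hw) (placeForm (Matrix.of fun i j : Fin 2 => if i.val + j.val + 1 = 2 then (1 : L) else 0) w.1)) : Set ↥(unitaryGroupOfForm (galAdicCompletionMap (L := L) (IsCMField.complexConj L) hw) (placeForm (Matrix.of fun i j : Fin 2 => if i.val + j.val + 1 = 2 then (1 : L) else 0) w.1))))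
      (ν' : Measure ↥(unitaryGroupOfForm (galAdicCompletionMap (L := L) (IsCMField.complexConj L) hw) (placeForm (Matrix.of fun i j : Fin 2 => if i.val + j.val + 1 = 2 then (1 : L) else 0) w.1))) [ν'.IsHaarMeasure] [ν'.IsMulRightInvariant]
      (tm' : Measure ↥(torusU (galAdicCompletionMap (L := L) (IsCMField.complexConj L) hw) (placeForm (Matrix.of fun i j : Fin 2 => if i.val + j.val + 1 = 2 then (1 : L) else 0) w.1))) [tm'.IsMulLeftInvariant] [IsFiniteMeasureOnCompacts tm'] [tm'.IsOpenPosMeasure] [tm'.IsInvInvariant],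
      ∀ t₀ : ↥(torusU (galAdicCompletionMap (L := L) (IsCMField.complexConj L) hw) (placeForm (Matrix.of fun i j : Fin 2 => if i.val + j.val + 1 = 2 then (1 : L) else 0) w.1)), IsRegularElt (((t₀ : ↥(unitaryGroupOfForm (galAdicCompletionMap (L := L) (IsCMField.complexConj L) hw) (placeForm (Matrix.of fun i j : Fin 2 => if i.val + j.val + 1 = 2 then (1 : L) else 0) w.1)))) : GL (Fin 2) (w.1.adicCompletion L)) →
        ∃ U : Set ↥(torusU (galAdicCompletionMap (L := L) (IsCMField.complexConj L) hw) (placeForm (Matrix.of fun i j : Fin 2 => if i.val + j.val + 1 = 2 then (1 : L) else 0) w.1)), IsOpen U ∧ t₀ ∈ U ∧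
          ∃ A₀ : Set (↥(unitaryGroupOfForm (galAdicCompletionMap (L := L) (IsCMField.complexConj L) hw) (placeForm (Matrix.of fun i j : Fin 2 => if i.val + j.val + 1 = 2 then (1 : L) else 0) w.1)) ⧸ torusU (galAdicCompletionMap (L := L) (IsCMField.complexConj L) hw) (placeForm (Matrix.of fun i j : Fin 2 => if i.val + j.val + 1 = 2 then (1 : L) else 0) w.1)), MeasurableSet A₀ ∧
            quotientMeasure _ tm' hT'c ν' A₀ ≠ 0 ∧ quotientMeasure _ tm' hT'c ν' A₀ ≠ ∞ ∧
            ∀ V : Set ↥(torusU (galAdicCompletionMap (L := L) (IsCMField.complexConj L) hw) (placeForm (Matrix.of fun i j : Fin 2 => if i.val + j.val + 1 = 2 then (1 : L) else 0) w.1)), MeasurableSet V → V ⊆ U →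
              (∀ t ∈ V, IsRegularElt (((t : ↥(unitaryGroupOfForm (galAdicCompletionMap (L := L) (IsCMField.complexConj L) hw) (placeForm (Matrix.of fun i j : Fin 2 => if i.val + j.val + 1 = 2 then (1 : L) else 0) w.1)))) : GL (Fin 2) (w.1.adicCompletion L))) →
              (∀ n : ↥(unitaryGroupOfForm (galAdicCompletionMap (L := L) (IsCMField.complexConj L) hw) (placeForm (Matrix.of fun i j : Fin 2 => if i.val + j.val + 1 = 2 then (1 : L) else 0) w.1)), n ∉ torusU (galAdicCompletionMap (L := L) (IsCMField.complexConj L) hw) (placeForm (Matrix.of fun i j : Fin 2 => if i.val + j.val + 1 = 2 then (1 : L) else 0) w.1) →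
                ∀ t ∈ V, ∀ t' ∈ V, ((t' : ↥(torusU (galAdicCompletionMap (L := L) (IsCMField.complexConj L) hw) (placeForm (Matrix.of fun i j : Fin 2 => if i.val + j.val + 1 = 2 then (1 : L) else 0) w.1))) : ↥(unitaryGroupOfForm (galAdicCompletionMap (L := L) (IsCMField.complexConj L) hw) (placeForm (Matrix.of fun i j : Fin 2 => if i.val + j.val + 1 = 2 then (1 : L) else 0) w.1))) ≠ n * t * n⁻¹) →
                ν' (Φ' '' (A₀ ×ˢ V)) = quotientMeasure _ tm' hT'c ν' A₀ *
                  ∫⁻ t in V, ↑(NNReal.sqrt (normAbs (w.1.adicCompletion L) (((((t : ↥(unitaryGroupOfForm (galAdicCompletionMap (L := L) (IsCMField.complexConj L) hw) (placeForm (Matrix.of fun i j : Fin 2 => if i.val + j.val + 1 = 2 then (1 : L) else 0) w.1))) : GL (Fin 2) (w.1.adicCompletion L)) : Matrix (Fin 2) (Fin 2) (w.1.adicCompletion L)) 0 0) * galAdicCompletionMap (L := L) (IsCMField.complexConj L) hw ((((t : ↥(unitaryGroupOfForm (galAdicCompletionMap (L := L) (IsCMField.complexConj L) hw) (placeForm (Matrix.of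 fun i j : Fin 2 => if i.val + j.val + 1 = 2 then (1 : L) else 0) w.1))) : GL (Fin 2) (w.1.adicCompletion L)) : Matrix (Fin 2) (Fin 2) (w.1.adicCompletion L)) 0 0) - 1) * normAbs (w.1.adicCompletion L) ((((((t : ↥(unitaryGroupOfForm (galAdicCompletionMap (L := L) (IsCMField.complexConj L) hw) (placeForm (Matrix.of fun i j : Fin 2 => if i.val + j.val + 1 = 2 then (1 : L) else 0) w.1))) : GL (Fin 2) (w.1.adicCompletion L)) : Matrix (Fin 2) (Fin 2) (w.1.adicCompletion L)) 0 0) * galAdicCompletionMap (L := L) (IsCMField.complexConj L) hw ((((t : ↥(unitaryGroupOfForm (galAdicCompletionMap (L := L) (IsCMField.complexConj L) hw) (placeForm (Matrix.of fun i j : Fin 2 => if i.val + j.val + 1 = 2 then (1 : L) else 0) w.1))) : GL (Fin 2) (w.1.adicCompletion L)) : Matrix (Fin 2) (Fin 2) (w.1.adicCompletion L)) 0 0))⁻¹ - 1))) ∂tm') :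
    ∀ t₀ : ↥T, IsRegularElt (((t₀ : (UnitaryGroup.cmDatum L 2 (Matrix.of fun i j : Fin 2 => if i.val + j.val + 1 = 2 then (1 : L) else 0)).Local v)).val : GL (Fin 2) (UnitaryGroup.LocalRing L v)) →
      ∃ U : Set ↥T, IsOpen U ∧ t₀ ∈ U ∧
        ∃ A₀ : Set ((UnitaryGroup.cmDatum L 2 (Matrix.of fun i j : Fin 2 => if i.val + j.val + 1 = 2 then (1 : L) else 0)).Local v ⧸ T), MeasurableSet A₀ ∧ (quotientMeasure T tm hTc ν) A₀ ≠ 0 ∧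
          (quotientMeasure T tm hTc ν) A₀ ≠ ∞ ∧
          ∀ V : Set ↥T, MeasurableSet V → V ⊆ U → (∀ t ∈ V, IsRegularElt (((t : (UnitaryGroup.cmDatum L 2 (Matrix.of fun i j : Fin 2 => if i.val + j.val + 1 = 2 then (1 : L) else 0)).Local v)).val : GL (Fin 2) (UnitaryGroup.LocalRing L v))) →
            (∀ n : (UnitaryGroup.cmDatum L 2 (Matrix.of fun i j : Fin 2 => if i.val + j.val + 1 = 2 then (1 : L) else 0)).Local v, n ∉ T → ∀ t ∈ V, ∀ t' ∈ V, ((t' : ↥T) : (UnitaryGroup.cmDatum L 2 (Matrix.of fun i j : Fin 2 => if i.val + j.val + 1 = 2 then (1 : L) else 0)).Local v) ≠ n * t * n⁻¹) →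
              ν (Φ '' (A₀ ×ˢ V)) = (quotientMeasure T tm hTc ν) A₀ *
                ∫⁻ t in V, ↑(NNReal.sqrt ((∏ w' : PlacesOver L v, normAbs (w'.1.adicCompletion L) ((((t : (UnitaryGroup.cmDatum L 2 (Matrix.of fun i j : Fin 2 => if i.val + j.val + 1 = 2 then (1 : L) else 0)).Local v).val : GL (Fin 2) (UnitaryGroup.LocalRing L v)).val.charpoly.discr) w')) * (∏ w' : PlacesOver L v, normAbs (w'.1.adicCompletion L) ((((t : (UnitaryGroup.cmDatum L 2 (Matrix.of fun i j : Fin 2 => if i.val + j.val + 1 = 2 then (1 : L) else 0)).Local v).val : GL (Fin 2) (UnitaryGroup.LocalRing L v)).val.det) w'))⁻¹)) ∂tm := by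
  refine tubeJacobianLocal_splitCartan_U2_of_model L v hns w hw hT₂ Φ hΦ hTc ν tm ?_
  intro _i₁ _i₂ _i₃ _i₄ _i₅ _i₆ _i₇ Φ' hΦ' hT'c ν' _i₈ _i₉ tm' _i₁₀ _i₁₁ _i₁₂ _i₁₃ t₀ ht₀
  obtain ⟨U, hU, ht₀U, A₀, hA₀, h0, htop, hV⟩ := hmodel₂ Φ' hΦ' hT'c ν' tm' t₀ ht₀
  refine ⟨U, hU, ht₀U, A₀, hA₀, h0, htop, fun V hVm hVU hreg hsep => ?_⟩
  rw [hV V hVm hVU hreg hsep]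
  congr 1
  refine lintegral_congr fun t => ?_
  rw [sqrt_normAbs_neg_discr_div_det_eq_of_mem_torusU (galAdicCompletionMap (L := L) (IsCMField.complexConj L) hw)
    (F0P3cCMLocalNonsplitBorelTransportU2.placeForm_antidiagTwo_eq L v w) t.2]

end CMTwo

end Summit.HodgeConjecture.HodgeConjecture.Cruxes.H413.F0P3cStCharTSUpTrJacSplitDockTwo

end
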